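import Mathlib
import Literature.Analysis.FluidPDE.ClassicalSolution

/-!
# Lin–Wang: optimal three-cylinder inequality for the generalized non-stationary Stokes system

C.-L. Lin, J.-N. Wang, *Quantitative uniqueness estimates for the generalized non-stationary Stokes
system*, Applicable Analysis 101 (2022), no. 10, 3591–3611, doi:10.1080/00036811.2020.1747611
(online 2020; statement read from the authors' preprint `time-stokes9.pdf` [galaxy:pdf:1857862180],
p. 1: (1.1), (1.2), Thm 1.1; p. 2: the formula for `κ`, Thm 1.2, Cor 1.3; p. 14: the proof's
"choosing R̃₃ sufficiently small, if necessary").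

## What is printed (Thm 1.1)

Setting: `Ω ⊂ ℝⁿ` bounded connected with `0 ∈ Ω`, `n ≥ 2`; the generalized non-stationary Stokes
system `∂ₜu − Δu + A(t,x)·∇u + B(t,x)u + ∇p = 0`, `div u = 0` in `(−1,1) × Ω` (1.1), with
`|A(t,x)| ≤ λ|x|^{−1+ε}`, `|B(t,x)| ≤ λ|x|^{−2+ε}` for `t ∈ (−1,1)` (1.2), `λ > 0`, `0 < ε < 1`;
`u ∈ H¹((−1,1); H²_loc(Ω))` with a pressure `p ∈ L²((−1,1); H¹_loc(Ω))`;
`Q^{s,τ}_{x,R} = (s−τ, s+τ) × B_R(x)`.  **Theorem 1.1**: given `0 < t₀ < T ≤ 1`, "for any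
`R̂ < 1` such that if `0 < R₁ < R₂ < R₃/3 < R̂` then"
`∬_{Q^{0,T−t₀}_{0,R₂}} |u|² ≤ C̃ (∬_{Q^{0,T}_{0,R₁}} |u|²)^κ (∬_{Q^{0,T}_{0,R₃}} |u|²)^{1−κ}` (1.3),
where `C̃` depends on `ε, λ, n, T, t₀, R₂/R₃` and
`κ = log(2R₃/(3R₂)) / (4 log(4R₂/R₁) + log(2R₃/(3R₂)))`; "the optimality of (1.3) is due to the
fact that `κ ∼ −1/log R₁`".

## What is typed (a special case implied by print)

`n = 3`; `(u,p)` classical (jointly `C^∞`) on `(s − T', s + T') × ℝ³` for some `T' > 1` and an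
arbitrary time centre `s` (print: `s = 0`; translate), hence in the printed Sobolev classes on
`(s−1,s+1) × K` for every compact `K`; print applied with `Ω = B₃(0)`; coefficient bounds imposed on
`(s−1,s+1) × (ℝ³ ∖ {0})`; the outer-radius clause is typed in its WEAKER form — a threshold
`∃ R̂ = R̂(λ, ε) > 0` with `R₃/3 < R̂` (the preprint's "for any R̂ < 1 such that if …" is
grammatically ambiguous and the proof, p. 14, "choos[es] R̃₃ sufficiently small, if necessary" to
absorb the singular lower-order terms; the threshold form is implied by either reading); the constant
may depend on `R₂, R₃` separately (print: on `R₂/R₃`) but NOT on `R₁` nor on the solution — this and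
the explicit exponent `linWangKappa` are the content.  Stated as a named fact (`def … : Prop`), not
proved here (Carleman estimates; no Mathlib/tree unique-continuation machinery of this kind — the
tree's `BackwardUniqueness*` / `CarlemanRegularityC12` chain is the ESŠ backward-uniqueness setting).

-- TODO(general form): `n ≥ 2`, bounded `Ω`, Sobolev-class solutions, constant depending on `R₂/R₃` only.
-/

open MeasureTheory Set Function Filter Topology
open scoped ENNReal Laplacian ContDiff

namespace Literature.Analysis.FluidPDE

/-- (L0) The classical generalized non-stationary Stokes system of Lin–Wang ((1.1) with `ν = 1`):
`∂ₜu + (A·∇)u + B u = Δu − ∇p`, `div u = 0`, pointwise on `S × ℝ³`, with `u`, `p` jointly smooth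
on `S × ℝ³`; `A` is a drift field and `B` a field of linear maps (zeroth-order coefficient).
[cite: LinWang2022, (1.1)] -/
def IsClassicalGenStokesOn (S : Set ℝ)
    (A : ℝ → EuclideanSpace ℝ (Fin 3) → EuclideanSpace ℝ (Fin 3))
    (B : ℝ → EuclideanSpace ℝ (Fin 3) → (EuclideanSpace ℝ (Fin 3) →L[ℝ] EuclideanSpace ℝ (Fin 3)))
    (u : ℝ → EuclideanSpace ℝ (Fin 3) → EuclideanSpace ℝ (Fin 3))
    (p : ℝ → EuclideanSpace ℝ (Fin 3) → ℝ) : Prop :=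
  IsSmoothSpaceTimeOn S u ∧ IsSmoothSpaceTimeOn S p ∧
    (∀ t ∈ S, ∀ x, timeDerivWithin S u t x + convect (A t) (u t) x + B t x (u t x) =
        (Δ (u t)) x - gradient (p t) x) ∧
    (∀ t ∈ S, VectorCalculus.IsDivFree (u t))

/-- (L0′) Lin–Wang's three-cylinder exponent `κ = log(2R₃/(3R₂)) / (4 log(4R₂/R₁) + log(2R₃/(3R₂)))`
(p. 2, display after (1.3)); `κ ∼ −1/log R₁` as `R₁ → 0`. [cite: LinWang2022, p. 2] -/
noncomputable def linWangKappa (R₁ R₂ R₃ : ℝ) : ℝ :=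
  Real.log (2 * R₃ / (3 * R₂)) / (4 * Real.log (4 * R₂ / R₁) + Real.log (2 * R₃ / (3 * R₂)))

/-- (L0″) The exponent lies in `(0,1)` in the admissible range `0 < R₁ < R₂ < R₃/3` (so the printed
three-cylinder inequality is a genuine interpolation). [cite: LinWang2022, p. 2 (formula for κ)] -/
theorem linWangKappa_pos_lt_one {R₁ R₂ R₃ : ℝ} (hR₁ : 0 < R₁) (hR₁₂ : R₁ < R₂)
    (hR₂₃ : R₂ < R₃ / 3) : 0 < linWangKappa R₁ R₂ R₃ ∧ linWangKappa R₁ R₂ R₃ < 1 := by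
  have hR₂ : 0 < R₂ := hR₁.trans hR₁₂
  have h1 : 1 < 2 * R₃ / (3 * R₂) := by
    rw [lt_div_iff₀ (by positivity)]; linarith
  have h2 : 1 < 4 * R₂ / R₁ := by
    rw [lt_div_iff₀ hR₁]; linarith
  have hl1 : 0 < Real.log (2 * R₃ / (3 * R₂)) := Real.log_pos h1
  have hl2 : 0 < Real.log (4 * R₂ / R₁) := Real.log_pos h2
  unfold linWangKappa
  constructor
  · positivity
  · rw [div_lt_one (by positivity)]; linarith

/-- (L1) **Typed fact (special case of Lin–Wang 2022, Thm 1.1; NOT proved here, used as a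
hypothesis).** Optimal three-cylinder inequality for classical solutions of the generalized
Stokes system on `ℝ³` with coefficients `|A(t,x)| ≤ λ|x|^{−1+ε}`, `|B(t,x)| ≤ λ|x|^{−2+ε}` on the
unit time window around `s`, for outer radii below a threshold `R̂(λ, ε) > 0`: the constant depends
only on `(λ, ε, T, t₀, R₂, R₃)` — not on `R₁`, not on the solution — and the exponent is
`linWangKappa R₁ R₂ R₃`.
[cite: LinWang2022, Thm 1.1] -/
def LinWang2022ThreeCylinder : Prop :=
  ∀ (lam eps : ℝ), 0 < lam → 0 < eps → eps < 1 →
  ∃ Rhat : ℝ, 0 < Rhat ∧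
  ∀ (T t₀ : ℝ), 0 < t₀ → t₀ < T → T ≤ 1 →
  ∀ (R₂ R₃ : ℝ), 0 < R₂ → R₂ < R₃ / 3 → R₃ / 3 < Rhat →
  ∃ C : ℝ, 0 < C ∧ ∀ (R₁ : ℝ), 0 < R₁ → R₁ < R₂ →
    ∀ (s T' : ℝ), 1 < T' →
    ∀ (A : ℝ → EuclideanSpace ℝ (Fin 3) → EuclideanSpace ℝ (Fin 3))
      (B : ℝ → EuclideanSpace ℝ (Fin 3) → (EuclideanSpace ℝ (Fin 3) →L[ℝ] EuclideanSpace ℝ (Fin 3)))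
      (u : ℝ → EuclideanSpace ℝ (Fin 3) → EuclideanSpace ℝ (Fin 3))
      (p : ℝ → EuclideanSpace ℝ (Fin 3) → ℝ),
      (∀ t ∈ Ioo (s - 1) (s + 1), ∀ x : EuclideanSpace ℝ (Fin 3), x ≠ 0 →
          ‖A t x‖ ≤ lam * ‖x‖ ^ (-1 + eps)) →
      (∀ t ∈ Ioo (s - 1) (s + 1), ∀ x : EuclideanSpace ℝ (Fin 3), x ≠ 0 →
          ‖B t x‖ ≤ lam * ‖x‖ ^ (-2 + eps)) →
      IsClassicalGenStokesOn (Ioo (s - T') (s + T')) A B u p →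
      ∫ z in Ioo (s - (T - t₀)) (s + (T - t₀)) ×ˢ Metric.ball (0 : EuclideanSpace ℝ (Fin 3)) R₂,
          ‖u z.1 z.2‖ ^ 2 ≤
        C * (∫ z in Ioo (s - T) (s + T) ×ˢ Metric.ball (0 : EuclideanSpace ℝ (Fin 3)) R₁,
                ‖u z.1 z.2‖ ^ 2) ^ linWangKappa R₁ R₂ R₃ *
            (∫ z in Ioo (s - T) (s + T) ×ˢ Metric.ball (0 : EuclideanSpace ℝ (Fin 3)) R₃,
                ‖u z.1 z.2‖ ^ 2) ^ (1 - linWangKappa R₁ R₂ R₃)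

/-- Inner-radius–hedged form of `LinWang2022ThreeCylinder` (the shape used by the ROUND-48 census
helpers of route TypeIQuarterGate/ScarEnvelopeTypeI: an additional solution-independent bound
`R₁ ≤ ρ`, `ρ > 0`).  It is IMPLIED by the vendored fact (take `ρ := R₂`): the printed Thm 1.1 allows
every `0 < R₁ < R₂`. [cite: LinWang2022, Thm 1.1] -/
theorem LinWang2022ThreeCylinder.innerRadiusHedged (hLW : LinWang2022ThreeCylinder) :
    ∀ (lam eps : ℝ), 0 < lam → 0 < eps → eps < 1 →
    ∃ Rhat : ℝ, 0 < Rhat ∧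
    ∀ (T t₀ : ℝ), 0 < t₀ → t₀ < T → T ≤ 1 →
    ∀ (R₂ R₃ : ℝ), 0 < R₂ → R₂ < R₃ / 3 → R₃ / 3 < Rhat →
    ∃ C : ℝ, 0 < C ∧ ∃ ρ : ℝ, 0 < ρ ∧ ∀ (R₁ : ℝ), 0 < R₁ → R₁ < R₂ → R₁ ≤ ρ →
      ∀ (s T' : ℝ), 1 < T' →
      ∀ (A : ℝ → EuclideanSpace ℝ (Fin 3) → EuclideanSpace ℝ (Fin 3))
        (B : ℝ → EuclideanSpace ℝ (Fin 3) → (EuclideanSpace ℝ (Fin 3) →L[ℝ] EuclideanSpace ℝ (Fin 3)))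
        (u : ℝ → EuclideanSpace ℝ (Fin 3) → EuclideanSpace ℝ (Fin 3))
        (p : ℝ → EuclideanSpace ℝ (Fin 3) → ℝ),
        (∀ t ∈ Ioo (s - 1) (s + 1), ∀ x : EuclideanSpace ℝ (Fin 3), x ≠ 0 →
            ‖A t x‖ ≤ lam * ‖x‖ ^ (-1 + eps)) →
        (∀ t ∈ Ioo (s - 1) (s + 1), ∀ x : EuclideanSpace ℝ (Fin 3), x ≠ 0 →
            ‖B t x‖ ≤ lam * ‖x‖ ^ (-2 + eps)) →
        IsClassicalGenStokesOn (Ioo (s - T') (s + T')) A B u p →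
        ∫ z in Ioo (s - (T - t₀)) (s + (T - t₀)) ×ˢ Metric.ball (0 : EuclideanSpace ℝ (Fin 3)) R₂,
            ‖u z.1 z.2‖ ^ 2 ≤
          C * (∫ z in Ioo (s - T) (s + T) ×ˢ Metric.ball (0 : EuclideanSpace ℝ (Fin 3)) R₁,
                  ‖u z.1 z.2‖ ^ 2) ^ linWangKappa R₁ R₂ R₃ *
              (∫ z in Ioo (s - T) (s + T) ×ˢ Metric.ball (0 : EuclideanSpace ℝ (Fin 3)) R₃,
                  ‖u z.1 z.2‖ ^ 2) ^ (1 - linWangKappa R₁ R₂ R₃) := by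
  intro lam eps hlam heps heps1
  obtain ⟨Rhat, hRhat, h⟩ := hLW lam eps hlam heps heps1
  refine ⟨Rhat, hRhat, fun T t₀ ht₀ htT hT1 R₂ R₃ hR₂ hR₂₃ hR₃ => ?_⟩
  obtain ⟨C, hC, hmain⟩ := h T t₀ ht₀ htT hT1 R₂ R₃ hR₂ hR₂₃ hR₃
  exact ⟨C, hC, R₂, hR₂, fun R₁ hR₁ hR₁₂ _ => hmain R₁ hR₁ hR₁₂⟩

end Literature.Analysis.FluidPDE
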